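import Literature.NumberTheory.Sieve.IwaniecAlmostPrimesQuadraticWeightedSum
import Literature.NumberTheory.Sieve.IwaniecAlmostPrimesMertens
import Literature.NumberTheory.Sieve.AletheiaZomleferFukshanskyGarcia2020ApplicationsQuadraticProofs
import Literature.NumberTheory.QuadraticFields.KroneckerCharacterFourProofs
import Literature.NumberTheory.LFunctions.CharacterVonMangoldtSums
import Literature.NumberTheory.LFunctions.MertensTail
import HarnessLib

/-!
# Iwaniec (1978) for a general quadratic: Mertens' first theorem for `ρ_G` and condition (1) of Lemma 2 — PROVED

Sequel to `IwaniecAlmostPrimesQuadraticWeightedSum.lean` (H. Iwaniec, *Almost-primes represented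
by quadratic polynomials*, Invent. Math. **47** (1978) 171–188 [cite: IwaniecInventiones1978,
§5 p. 185]; R. J. Lemke Oliver, Acta Arith. **151** (2012) 241–261
[cite: LemkeOliverActaArith2012, Lemma 2 and §2.3]) and the general-`G` counterpart of
`IwaniecAlmostPrimesMertens.lean` (which treats `n² + 1`, `ρ(p) = 1 + χ₄(p)`).  The proof of
Proposition 2 feeds `ℬ = 𝒜_q` with `ω = ρ_G` into Iwaniec's bilinear linear sieve
(`lemma2_bilinearSieve`, Acta Arith. **37** (1980) Thm 1), whose hypothesis (1) is the one-sided
Mertens condition `∏_{w ≤ p < z} (1 − ω(p)/p)⁻¹ ≤ (log z/log w)(1 + K/log w)` with a constant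
`K`; for `ω = ρ_G` this needs Mertens' first theorem for `ρ_G` with a BOUNDED error,
`∑_{p ≤ x} ρ_G(p) log p/p = log x + O_G(1)` (Lemke Oliver, Lemma 2 hypothesis / Kapoor's Lemma 14
via Nagell), i.e. Mertens' estimate `∑_{p ≤ x} χ_Δ(p) log p/p = O(1)` for the quadratic character
`χ_Δ = (Δ/·)`, `Δ = b² − 4ac` the discriminant.  Everything here is PROVED, for every
`G = aX² + bX + c` with `a > 0`, `c` odd, `G` irreducible in `ℤ[X]`:

* `gcd_coeffs_eq_one` (`G` is primitive), `rhoG_eq_one_add_jacobiSym` — `ρ_G(p) = 1 + (Δ/p)`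
  for odd primes `p ∤ a` (the tree's `polyRootCountMod_quadratic_odd_holds`, AZFG 2020 §6.5);
* with `χ` the Dirichlet character mod `4|Δ|` with `χ(n) = (Δ/n)` for odd `n`
  (`QuadraticFields.exists_dirichletCharacter_four_mul`): `rhoG_eq_one_add_re` (`ρ_G(p) = 1 +
  Re χ(p)`, odd `p ∤ a`), and **`ne_one_of_forall_odd`** — `χ` is NON-PRINCIPAL: otherwise
  `ρ_G(p) = 2` for all primes `p ∤ 2aΔ`, so `∑_{p ≤ n} (1 − ρ_G(p))/p = −∑_{p ≤ n} 1/p + O(1)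
  → −∞`, contradicting the convergence of that series for the Bateman–Horn system `{G}`
  (`AZFG2020_tendsto_sum_sub_omega_div_holds`, PROVED in the tree from the Dedekind zeta residue)
  and Mertens' second theorem;
* **`rhoMertensStrongG`** — `|∑_{p ≤ t} ρ_G(p) log p/p − log t| ≤ C_G` for `t ≥ 1`, from the
  tree's Mertens estimate for a real non-principal character
  (`CharacterMertens.exists_abs_sum_primesLE_re_mul_log_div_le`, Landau / Montgomery–Vaughan
  §4.3, using `L(1, χ) > 0`) and the two-sided Mertens I (`MertensBound.sum_log_div_prime_bounds`);
* `sum_Ioc_rhoG_div_le`, `sum_rhoG_div_filter_le`, `exists_sum_rhoG_div_filter_le` — the tail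
  form of Mertens II for `ρ_G`, `∑_{w ≤ p < z} ρ_G(p)/p ≤ log(log z/log w) + C₂/log w`
  (partial summation);
* `prod_inv_one_sub_rhoG_div_le`, **`rhoG_sieveConditionOne`** — condition (1) of Lemma 2 for
  `ω = ρ_G` with an explicit `K = K_G ≥ 1` (`ρ_G(p)/p ≤ 2/3`, `(1 − t)⁻¹ ≤ e^{t + 3t²}` for
  `t ≤ 2/3`).

## References

* H. Iwaniec, Invent. Math. 47 (1978) 171–188, §5 p. 185 (`IwaniecInventiones1978`).
* R. J. Lemke Oliver, Acta Arith. 151 (2012) 241–261, Lemma 2, §2.3 (`LemkeOliverActaArith2012`).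
* H. Iwaniec, Acta Arith. 37 (1980) 307–320, condition (1) p. 308 (`IwaniecActaArith1980b`).
* H. L. Montgomery, R. C. Vaughan, *Multiplicative Number Theory I*, CUP 2007, §4.3
  (`MontgomeryVaughan2007`).
-/

open Finset Real Filter MeasureTheory Polynomial
open scoped Topology NumberTheorySymbols

noncomputable section

namespace Literature.NumberTheory.Sieve.Iwaniec1978

variable {a b c : ℤ}

/-! ### `ρ_G(p) = 1 + (Δ/p)` for odd `p ∤ a` -/

/-- An irreducible quadratic `aX² + bX + c` (`a ≠ 0`) is primitive: `gcd(a, b, c) = 1`.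
[folklore] -/
theorem gcd_coeffs_eq_one (ha : a ≠ 0) (hirr : Irreducible (quadPoly a b c)) :
    Int.gcd (Int.gcd a b) c = 1 := by
  by_contra h
  set g : ℕ := Int.gcd (Int.gcd a b) c with hg
  have hp := Nat.minFac_prime h
  set p := g.minFac with hpdef
  have hpg : (p : ℤ) ∣ (g : ℤ) := Int.natCast_dvd_natCast.mpr (Nat.minFac_dvd g)
  have hgab : (g : ℤ) ∣ (Int.gcd a b : ℤ) := Int.gcd_dvd_left _ _
  have hgc : (g : ℤ) ∣ c := Int.gcd_dvd_right _ _
  have hab_a : ((Int.gcd a b : ℕ) : ℤ) ∣ a := Int.gcd_dvd_left _ _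
  have hab_b : ((Int.gcd a b : ℕ) : ℤ) ∣ b := Int.gcd_dvd_right _ _
  exact false_of_prime_dvd_coeffs ha hirr hp ((hpg.trans hgab).trans hab_a)
    ((hpg.trans hgab).trans hab_b) (hpg.trans hgc)

/-- **`ρ_G(p) = 1 + (Δ/p)` for an odd prime `p ∤ a`**, `Δ = b² − 4ac` (completing the square;
AZFG 2020 §6.5, the tree's `polyRootCountMod_quadratic_odd_holds`).
[cite: AletheiaZomleferFukshanskyGarcia2020, §6.5] -/
theorem rhoG_eq_one_add_jacobiSym (ha : 0 < a) (hirr : Irreducible (quadPoly a b c)) {p : ℕ}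
    (hp : p.Prime) (hp2 : p ≠ 2) (hpa : ¬ (p : ℤ) ∣ a) :
    (rhoG a b c p : ℤ) = 1 + J(b ^ 2 - 4 * a * c | p) := by
  have h := polyRootCountMod_quadratic_odd_holds a b c ha (gcd_coeffs_eq_one ha.ne' hirr) p hp
    (lt_of_le_of_ne hp.two_le (Ne.symm hp2))
  rw [if_neg hpa] at h
  exact h

/-! ### The character `χ_Δ` mod `4|Δ|` and its non-principality -/

section Character

variable {χ : DirichletCharacter ℂ (4 * (b ^ 2 - 4 * a * c).natAbs)}

/-- `Re χ(p) = (Δ/p)` at an odd prime `p`, for `χ(n) = (Δ/n)` (`n` odd). [folklore] -/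
theorem re_apply_prime_eq_jacobiSym
    (hχ : ∀ n : ℕ, Odd n → χ n = (J(b ^ 2 - 4 * a * c | n) : ℂ)) {p : ℕ} (hp : p.Prime)
    (hp2 : p ≠ 2) : (χ p).re = (J(b ^ 2 - 4 * a * c | p) : ℝ) := by
  rw [hχ p (hp.odd_of_ne_two hp2)]
  norm_cast

/-- **`ρ_G(p) = 1 + Re χ_Δ(p)` for odd primes `p ∤ a`.** [folklore] -/
theorem rhoG_eq_one_add_re (ha : 0 < a) (hirr : Irreducible (quadPoly a b c))
    (hχ : ∀ n : ℕ, Odd n → χ n = (J(b ^ 2 - 4 * a * c | n) : ℂ)) {p : ℕ} (hp : p.Prime)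
    (hp2 : p ≠ 2) (hpa : ¬ (p : ℤ) ∣ a) : (rhoG a b c p : ℝ) = 1 + (χ p).re := by
  rw [re_apply_prime_eq_jacobiSym hχ hp hp2]
  have h := rhoG_eq_one_add_jacobiSym ha hirr hp hp2 hpa
  have h' : ((rhoG a b c p : ℤ) : ℝ) = ((1 + J(b ^ 2 - 4 * a * c | p) : ℤ) : ℝ) := by rw [h]
  push_cast at h'
  exact h'

/-- `|Re χ(x)| ≤ 1`. [folklore] -/
theorem abs_re_apply_le_one (x : ZMod (4 * (b ^ 2 - 4 * a * c).natAbs)) : |(χ x).re| ≤ 1 :=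
  (Complex.abs_re_le_norm _).trans (DirichletCharacter.norm_le_one χ x)

/-- The finite set of "bad" primes `{2} ∪ {p ∣ a}` outside which `ρ_G(p) = 1 + Re χ_Δ(p)`.
[folklore] -/
theorem rhoG_eq_one_add_re_of_not_mem (ha : 0 < a) (hirr : Irreducible (quadPoly a b c))
    (hχ : ∀ n : ℕ, Odd n → χ n = (J(b ^ 2 - 4 * a * c | n) : ℂ)) {p : ℕ} (hp : p.Prime)
    (hmem : p ∉ insert 2 a.natAbs.primeFactors) : (rhoG a b c p : ℝ) = 1 + (χ p).re := by
  rw [Finset.mem_insert, not_or, Nat.mem_primeFactors] at hmem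
  refine rhoG_eq_one_add_re ha hirr hχ hp hmem.1 fun h => hmem.2 ⟨hp, ?_, ?_⟩
  · exact Int.ofNat_dvd_left.mp h
  · exact Int.natAbs_ne_zero.mpr ha.ne'

/-- **The character `χ_Δ` is non-principal** (`G` irreducible ⟹ `Δ` is not a square ⟹
`(Δ/p) = −1` for some — in fact a positive density of — primes).  Proof by contradiction from two
PROVED asymptotics of the tree: if `χ = 1` then `ρ_G(p) = 2` for every prime `p ∤ 2aΔ`, so
`∑_{p ≤ n} (1 − ρ_G(p))/p + ∑_{p ≤ n} 1/p` is bounded, while the first sum converges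
(Bateman–Horn system `{G}`, `AZFG2020_tendsto_sum_sub_omega_div_holds`) and the second tends to
`+∞` (Mertens). [folklore] -/
theorem ne_one_of_forall_odd (ha : 0 < a) (hc : Odd c) (hirr : Irreducible (quadPoly a b c))
    (hχ : ∀ n : ℕ, Odd n → χ n = (J(b ^ 2 - 4 * a * c | n) : ℂ)) : χ ≠ 1 := by
  intro h1
  set Δ : ℤ := b ^ 2 - 4 * a * c with hΔ
  have hΔ0 : Δ ≠ 0 := disc_ne_zero ha.ne' hirr
  haveI : NeZero (4 * Δ.natAbs) := ⟨mul_ne_zero (by norm_num) (Int.natAbs_ne_zero.mpr hΔ0)⟩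
  -- outside the bad set `ρ_G(p) = 2`
  set Bad : Finset ℕ := insert 2 a.natAbs.primeFactors ∪ Δ.natAbs.primeFactors with hBad
  have hρ2 : ∀ p : ℕ, p.Prime → p ∉ Bad → (rhoG a b c p : ℝ) = 2 := by
    intro p hp hpB
    rw [hBad, Finset.mem_union, not_or] at hpB
    rw [rhoG_eq_one_add_re_of_not_mem ha hirr hχ hp hpB.1, h1]
    have hp2 : p ≠ 2 := fun h => hpB.1 (by rw [h]; exact Finset.mem_insert_self _ _)
    have hpΔ : ¬ p ∣ Δ.natAbs := fun h => hpB.2 (Nat.mem_primeFactors.mpr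
      ⟨hp, h, Int.natAbs_ne_zero.mpr hΔ0⟩)
    have hunit : IsUnit ((p : ℕ) : ZMod (4 * Δ.natAbs)) := by
      rw [ZMod.isUnit_iff_coprime]
      refine Nat.Coprime.mul_right ?_ ((Nat.Prime.coprime_iff_not_dvd hp).mpr hpΔ)
      rw [show (4 : ℕ) = 2 ^ 2 by norm_num]
      exact (Nat.coprime_primes hp Nat.prime_two |>.mpr hp2).pow_right 2
    rw [MulChar.one_apply hunit, Complex.one_re]
    norm_num
  -- the convergent series of the Bateman–Horn system `{G}`
  set f : Fin 1 → ℤ[X] := ![quadPoly a b c] with hf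
  obtain ⟨L, hL⟩ := AZFG2020_tendsto_sum_sub_omega_div_holds 1 f
    (isBatemanHornSystem_quadPoly ha hc hirr)
  -- Mertens: `∑_{p ≤ n} 1/p → ∞`
  have hM : Tendsto (fun n : ℕ => Literature.NumberTheory.LFunctions.Mertens.primeRecipSum n)
      atTop atTop := by
    have h := Literature.NumberTheory.LFunctions.Mertens.tendsto_primeRecipSum_sub_loglog
    have hll : Tendsto (fun t : ℝ => Real.log (Real.log t)) atTop atTop :=
      Real.tendsto_log_atTop.comp Real.tendsto_log_atTop
    have h2 := (h.add_atTop hll).comp tendsto_natCast_atTop_atTop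
    refine h2.congr fun n => ?_
    simp only [Function.comp_apply]
    ring
  -- but `∑_{p ≤ n} (1 − ρ_G(p))/p + ∑_{p ≤ n} 1/p = ∑_{p ≤ n, p ∈ Bad} (2 − ρ_G(p))/p ≤ 2 #Bad`
  have hbound : ∀ n : ℕ, (∑ p ∈ Nat.primesLE n, ((1 : ℕ) - (polyRootCountMod f p : ℝ)) / p) +
      Literature.NumberTheory.LFunctions.Mertens.primeRecipSum n ≤ 2 * Bad.card := by
    intro n
    rw [Literature.NumberTheory.LFunctions.Mertens.primeRecipSum, Nat.floor_natCast,
      ← Finset.sum_add_distrib]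
    have hterm : ∀ p ∈ Nat.primesLE n, ((1 : ℕ) - (polyRootCountMod f p : ℝ)) / p + (p : ℝ)⁻¹ =
        (2 - (rhoG a b c p : ℝ)) / p := by
      intro p _
      rw [rhoG, ← hf]; push_cast; ring
    rw [Finset.sum_congr rfl hterm,
      ← Finset.sum_filter_add_sum_filter_not (Nat.primesLE n) (fun p => p ∈ Bad)]
    have hzero : ∑ p ∈ (Nat.primesLE n).filter (fun p => p ∉ Bad), (2 - (rhoG a b c p : ℝ)) / p
        = 0 := by
      refine Finset.sum_eq_zero fun p hp => ?_
      rw [Finset.mem_filter, Nat.mem_primesLE] at hp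
      rw [hρ2 p hp.1.2 hp.2, sub_self, zero_div]
    rw [hzero, add_zero]
    calc ∑ p ∈ (Nat.primesLE n).filter (fun p => p ∈ Bad), (2 - (rhoG a b c p : ℝ)) / p
        ≤ ∑ p ∈ (Nat.primesLE n).filter (fun p => p ∈ Bad), (2 : ℝ) := by
          refine Finset.sum_le_sum fun p hp => ?_
          rw [Finset.mem_filter, Nat.mem_primesLE] at hp
          have hp1 : (1 : ℝ) ≤ p := by exact_mod_cast hp.1.2.one_lt.le
          have hρ0 : (0 : ℝ) ≤ rhoG a b c p := Nat.cast_nonneg _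
          rw [div_le_iff₀ (by linarith)]
          nlinarith
      _ = 2 * ((Nat.primesLE n).filter (fun p => p ∈ Bad)).card := by
          rw [Finset.sum_const, nsmul_eq_mul, mul_comm]
      _ ≤ 2 * Bad.card := by
          gcongr
          rw [Finset.filter_mem_eq_inter]
          exact Finset.inter_subset_right
  -- contradiction
  have hLev : ∀ᶠ n : ℕ in atTop,
      L - 1 ≤ ∑ p ∈ Nat.primesLE n, ((1 : ℕ) - (polyRootCountMod f p : ℝ)) / p :=
    (hL.eventually (Ici_mem_nhds (by linarith : L - 1 < L))).mono fun n hn => hn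
  have hMev := hM.eventually_gt_atTop (2 * (Bad.card : ℝ) - (L - 1))
  obtain ⟨n, hn1, hn2⟩ := (hLev.and hMev).exists
  linarith [hbound n]

end Character

/-! ### Mertens' first theorem for `ρ_G` with a bounded error -/

/-- `R_G(t) = ∑_{p ≤ t} ρ_G(p) log p / p`. [folklore] -/
def rhoLogSumG (a b c : ℤ) (t : ℝ) : ℝ :=
  ∑ p ∈ Nat.primesLE ⌊t⌋₊, (rhoG a b c p : ℝ) * Real.log p / p

/-- **Mertens' first theorem for `ρ_G` — PROVED**: there is `C = C_G` with
`|∑_{p ≤ t} ρ_G(p) log p/p − log t| ≤ C` for all `t ≥ 1` (Lemke Oliver's sieve-density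
hypothesis for `ρ_G`, Lemma 2; Kapoor's Lemma 14).  From `ρ_G(p) = 1 + Re χ_Δ(p)` off the
finitely many primes `p ∣ 2a`, the two-sided Mertens I of the tree, and Mertens' estimate
`∑_{p ≤ x} χ(p) log p/p = O(1)` for the real non-principal character `χ_Δ`
(`CharacterMertens.exists_abs_sum_primesLE_re_mul_log_div_le`, which uses `L(1, χ_Δ) > 0`).
[cite: LemkeOliverActaArith2012, Lemma 2] -/
theorem rhoMertensStrongG (ha : 0 < a) (hc : Odd c) (hirr : Irreducible (quadPoly a b c)) :
    ∃ C : ℝ, ∀ t : ℝ, 1 ≤ t → |rhoLogSumG a b c t - Real.log t| ≤ C := by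
  set Δ : ℤ := b ^ 2 - 4 * a * c with hΔ
  have hΔ0 : Δ ≠ 0 := disc_ne_zero ha.ne' hirr
  haveI : NeZero (4 * Δ.natAbs) := ⟨mul_ne_zero (by norm_num) (Int.natAbs_ne_zero.mpr hΔ0)⟩
  obtain ⟨χ, hχ⟩ := Literature.NumberTheory.QuadraticFields.exists_dirichletCharacter_four_mul Δ hΔ0
  have hne : χ ≠ 1 := ne_one_of_forall_odd ha hc hirr hχ
  have hquad : χ ^ 2 = 1 :=
    (Literature.NumberTheory.QuadraticFields.isQuadratic_of_forall_odd hΔ0 hχ).sq_eq_one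
  obtain ⟨K', hK'⟩ :=
    Literature.NumberTheory.LFunctions.CharacterMertens.exists_abs_sum_primesLE_re_mul_log_div_le
      χ hne hquad
  set Bad : Finset ℕ := insert 2 a.natAbs.primeFactors with hBad
  refine ⟨4 + K' + 4 * Bad.card, fun t ht => ?_⟩
  set N := ⌊t⌋₊ with hN
  have hM := Literature.NumberTheory.LFunctions.MertensBound.sum_log_div_prime_bounds ht
  -- decomposition `ρ_G(p) = 1 + Re χ(p) + e(p)`, `e` supported on `Bad`, `|e(p)| ≤ 4`
  set e : ℕ → ℝ := fun p => (rhoG a b c p : ℝ) - 1 - (χ p).re with he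
  have hdec : rhoLogSumG a b c t = ∑ p ∈ Nat.primesLE N, Real.log p / p +
      ∑ p ∈ Nat.primesLE N, (χ (p : ZMod (4 * Δ.natAbs))).re * Real.log p / p +
      ∑ p ∈ Nat.primesLE N, e p * Real.log p / p := by
    rw [rhoLogSumG, ← Finset.sum_add_distrib, ← Finset.sum_add_distrib]
    refine Finset.sum_congr rfl fun p _ => ?_
    simp only [he]
    ring
  have hE : |∑ p ∈ Nat.primesLE N, e p * Real.log p / p| ≤ 4 * Bad.card := by
    have hsupp : ∀ p ∈ Nat.primesLE N, p ∉ Bad → e p * Real.log p / p = 0 := by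
      intro p hp hpB
      have hpp := (Nat.mem_primesLE.mp hp).2
      simp only [he]
      rw [rhoG_eq_one_add_re_of_not_mem ha hirr hχ hpp hpB]
      ring
    have hzero : ∑ p ∈ (Nat.primesLE N).filter (fun p => p ∉ Bad), e p * Real.log p / p = 0 :=
      Finset.sum_eq_zero fun p hp => hsupp p (Finset.mem_filter.mp hp).1 (Finset.mem_filter.mp hp).2
    rw [← Finset.sum_filter_add_sum_filter_not (Nat.primesLE N) (fun p => p ∈ Bad), hzero,
      add_zero]
    refine (Finset.abs_sum_le_sum_abs _ _).trans ?_
    calc ∑ p ∈ (Nat.primesLE N).filter (fun p => p ∈ Bad), |e p * Real.log p / p|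
        ≤ ∑ p ∈ (Nat.primesLE N).filter (fun p => p ∈ Bad), (4 : ℝ) := by
          refine Finset.sum_le_sum fun p hp => ?_
          have hpp := (Nat.mem_primesLE.mp (Finset.mem_filter.mp hp).1).2
          have hp0 : (0 : ℝ) < p := by exact_mod_cast hpp.pos
          have hlog : Real.log p ≤ p := by
            have := Real.log_le_sub_one_of_pos hp0; linarith
          have hlog0 : 0 ≤ Real.log p := Real.log_nonneg (by exact_mod_cast hpp.one_lt.le)
          have hρ : (rhoG a b c p : ℝ) ≤ 2 := by exact_mod_cast rhoG_le_two ha hc hirr hpp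
          have hρ0 : (0 : ℝ) ≤ rhoG a b c p := Nat.cast_nonneg _
          have hre := abs_re_apply_le_one (χ := χ) (p : ZMod (4 * Δ.natAbs))
          rw [abs_le] at hre
          have he4 : |e p| ≤ 4 := by
            simp only [he]; rw [abs_le]; constructor <;> linarith [hre.1, hre.2]
          rw [abs_div, abs_mul, abs_of_nonneg hlog0, abs_of_pos hp0, div_le_iff₀ hp0]
          calc |e p| * Real.log p ≤ 4 * p := by
                exact mul_le_mul he4 hlog hlog0 (by norm_num)
            _ = 4 * p := rfl
      _ = 4 * ((Nat.primesLE N).filter (fun p => p ∈ Bad)).card := by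
          rw [Finset.sum_const, nsmul_eq_mul, mul_comm]
      _ ≤ 4 * Bad.card := by
          gcongr
          rw [Finset.filter_mem_eq_inter]
          exact Finset.inter_subset_right
  have hχK := hK' N
  rw [abs_le] at hE hχK ⊢
  rw [hdec]
  constructor <;> linarith [hM.1, hM.2, hE.1, hE.2, hχK.1, hχK.2]

/-! ### From Mertens I for `ρ_G` to the tail of Mertens II and condition (1) of Lemma 2 -/

/-- The prime-indicator form of `R_G(m)` used with Mathlib's Abel summation. [folklore] -/
theorem sum_Icc_ite_prime_rhoG_log_div (m : ℕ) :
    ∑ k ∈ Icc 0 m, (if k.Prime then (rhoG a b c k : ℝ) * Real.log k / k else 0) =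
      ∑ p ∈ Nat.primesLE m, (rhoG a b c p : ℝ) * Real.log p / p := by
  rw [Nat.primesLE_eq_filter_range, Finset.sum_filter, Nat.range_succ_eq_Icc_zero]

/-- Tail upper bound: `∑_{P < p ≤ Q} ρ_G(p)/p ≤ log log Q − log log P + 2C / log P`.
[folklore] -/
theorem sum_Ioc_rhoG_div_le {C : ℝ} (hC : ∀ t : ℝ, 1 ≤ t → |rhoLogSumG a b c t - Real.log t| ≤ C)
    {P Q : ℝ} (hP : 2 ≤ P) (hPQ : P ≤ Q) :
    ∑ p ∈ (Ioc ⌊P⌋₊ ⌊Q⌋₊).filter Nat.Prime, (rhoG a b c p : ℝ) / p ≤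
      Real.log (Real.log Q) - Real.log (Real.log P) + 2 * C / Real.log P := by
  have hP0 : (0 : ℝ) ≤ P := by linarith
  have hQ : 2 ≤ Q := hP.trans hPQ
  set cf : ℕ → ℝ := fun k => if k.Prime then (rhoG a b c k : ℝ) * Real.log k / k else 0 with hcdef
  set f : ℝ → ℝ := fun t => (Real.log t)⁻¹ with hf
  set g : ℝ → ℝ := fun t => -t⁻¹ / Real.log t ^ 2 with hg
  have hderiv : ∀ t : ℝ, 1 < t → HasDerivAt f (g t) t := by
    intro t ht
    exact (Real.hasDerivAt_log (show t ≠ 0 by linarith)).inv (Real.log_pos ht).ne'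
  have hmem : ∀ t ∈ Set.Icc P Q, t ∈ ({0}ᶜ : Set ℝ) := fun t ht =>
    Set.mem_compl_singleton_iff.mpr (show (0 : ℝ) < t by linarith [ht.1]).ne'
  have hlogne : ∀ t ∈ Set.Icc P Q, Real.log t ≠ 0 := fun t ht =>
    (Real.log_pos (by linarith [ht.1])).ne'
  have hgcont : ContinuousOn g (Set.Icc P Q) :=
    ContinuousOn.div (ContinuousOn.neg (continuousOn_inv₀.mono hmem))
      ((Real.continuousOn_log.mono hmem).pow 2) fun t ht => pow_ne_zero _ (hlogne t ht)
  have hf_diff : ∀ t ∈ Set.Icc P Q, DifferentiableAt ℝ f t := fun t ht =>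
    (hderiv t (by linarith [ht.1])).differentiableAt
  have hderiv_eq : Set.EqOn g (deriv f) (Set.Icc P Q) := fun t ht =>
    ((hderiv t (by linarith [ht.1])).deriv).symm
  have hg_int : IntegrableOn g (Set.Icc P Q) := hgcont.integrableOn_Icc
  have hf_int : IntegrableOn (deriv f) (Set.Icc P Q) :=
    hg_int.congr_fun hderiv_eq measurableSet_Icc
  -- Abel summation
  have habel := sum_mul_eq_sub_sub_integral_mul cf hP0 hPQ hf_diff hf_int
  have hlhs : ∑ k ∈ Ioc ⌊P⌋₊ ⌊Q⌋₊, f k * cf k =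
      ∑ p ∈ (Ioc ⌊P⌋₊ ⌊Q⌋₊).filter Nat.Prime, (rhoG a b c p : ℝ) / p := by
    rw [Finset.sum_filter]
    refine Finset.sum_congr rfl fun k _ => ?_
    simp only [hcdef]
    split_ifs with hk
    · have hk1 : (1 : ℝ) < k := by exact_mod_cast hk.one_lt
      have : Real.log k ≠ 0 := (Real.log_pos hk1).ne'
      show (Real.log k)⁻¹ * ((rhoG a b c k : ℝ) * Real.log k / k) = (rhoG a b c k : ℝ) / k
      field_simp
    · simp
  -- the partial sums
  have hS : ∀ t : ℝ, 1 ≤ t →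
      Real.log t - C ≤ ∑ k ∈ Icc 0 ⌊t⌋₊, cf k ∧ ∑ k ∈ Icc 0 ⌊t⌋₊, cf k ≤ Real.log t + C := by
    intro t ht
    rw [hcdef, sum_Icc_ite_prime_rhoG_log_div]
    have h := hC t ht
    rw [rhoLogSumG, abs_le] at h
    constructor <;> linarith [h.1, h.2]
  have hlogP : 0 < Real.log P := Real.log_pos (by linarith)
  have hlogQ : 0 < Real.log Q := Real.log_pos (by linarith)
  -- boundary terms
  have hbQ : f Q * ∑ k ∈ Icc 0 ⌊Q⌋₊, cf k ≤ 1 + C / Real.log Q := by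
    have := (hS Q (by linarith)).2
    calc f Q * ∑ k ∈ Icc 0 ⌊Q⌋₊, cf k ≤ (Real.log Q)⁻¹ * (Real.log Q + C) :=
          mul_le_mul_of_nonneg_left this (inv_nonneg.mpr hlogQ.le)
      _ = 1 + C / Real.log Q := by field_simp
  have hbP : 1 - C / Real.log P ≤ f P * ∑ k ∈ Icc 0 ⌊P⌋₊, cf k := by
    have := (hS P (by linarith)).1
    calc 1 - C / Real.log P = (Real.log P)⁻¹ * (Real.log P - C) := by field_simp
      _ ≤ (Real.log P)⁻¹ * ∑ k ∈ Icc 0 ⌊P⌋₊, cf k :=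
          mul_le_mul_of_nonneg_left this (inv_nonneg.mpr hlogP.le)
  -- the integral term
  have hint : -∫ t in Set.Ioc P Q, deriv f t * ∑ k ∈ Icc 0 ⌊t⌋₊, cf k ≤
      Real.log (Real.log Q) - C / Real.log Q - (Real.log (Real.log P) - C / Real.log P) := by
    have h1 : ∫ t in Set.Ioc P Q, deriv f t * ∑ k ∈ Icc 0 ⌊t⌋₊, cf k =
        ∫ t in Set.Ioc P Q, g t * ∑ k ∈ Icc 0 ⌊t⌋₊, cf k := by
      refine setIntegral_congr_fun measurableSet_Ioc fun t ht => ?_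
      rw [hderiv_eq (Set.Ioc_subset_Icc_self ht)]
    rw [h1, ← integral_neg]
    set F : ℝ → ℝ := fun t => Real.log (Real.log t) - C * (Real.log t)⁻¹ with hF
    set w : ℝ → ℝ := fun t => t⁻¹ / Real.log t ^ 2 * (Real.log t + C) with hw
    have hFderiv : ∀ t : ℝ, 1 < t → HasDerivAt F (w t) t := by
      intro t ht
      have ht0 : t ≠ 0 := by linarith
      have hl : Real.log t ≠ 0 := (Real.log_pos ht).ne'
      have hA := (Real.hasDerivAt_log ht0).log hl
      have hB := ((Real.hasDerivAt_log ht0).inv hl).const_mul C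
      have heq : t⁻¹ / Real.log t - C * (-t⁻¹ / Real.log t ^ 2) = w t := by
        simp only [hw]
        field_simp
        ring
      exact (hA.sub hB).congr_deriv heq
    have hwcont : ContinuousOn w (Set.Icc P Q) :=
      ContinuousOn.mul (ContinuousOn.div (continuousOn_inv₀.mono hmem)
        ((Real.continuousOn_log.mono hmem).pow 2) fun t ht => pow_ne_zero _ (hlogne t ht))
        ((Real.continuousOn_log.mono hmem).add continuousOn_const)
    have hFTC : ∫ t in Set.Ioc P Q, w t = F Q - F P := by
      rw [← intervalIntegral.integral_of_le hPQ]
      refine intervalIntegral.integral_eq_sub_of_hasDerivAt (fun t ht => hFderiv t ?_)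
        (hwcont.mono ?_).intervalIntegrable
      · rw [Set.uIcc_of_le hPQ] at ht; linarith [ht.1]
      · rw [Set.uIcc_of_le hPQ]
    have hFQP : F Q - F P =
        Real.log (Real.log Q) - C / Real.log Q - (Real.log (Real.log P) - C / Real.log P) := by
      simp only [hF, div_eq_mul_inv]
    rw [← hFQP, ← hFTC]
    have hint1 : IntegrableOn w (Set.Ioc P Q) :=
      hwcont.integrableOn_Icc.mono_set Set.Ioc_subset_Icc_self
    have hint2 : IntegrableOn (fun t => -(g t * ∑ k ∈ Icc 0 ⌊t⌋₊, cf k)) (Set.Ioc P Q) :=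
      ((integrableOn_mul_sum_Icc cf hP0 hg_int).mono_set Set.Ioc_subset_Icc_self).neg
    refine setIntegral_mono_on hint2 hint1 measurableSet_Ioc fun t ht => ?_
    have ht1 : 1 < t := by linarith [ht.1]
    have hpos : 0 ≤ t⁻¹ / Real.log t ^ 2 := by
      have : 0 < t := by linarith
      positivity
    have := (hS t ht1.le).2
    calc -(g t * ∑ k ∈ Icc 0 ⌊t⌋₊, cf k) = t⁻¹ / Real.log t ^ 2 * ∑ k ∈ Icc 0 ⌊t⌋₊, cf k := by
          simp only [hg]; ring
      _ ≤ t⁻¹ / Real.log t ^ 2 * (Real.log t + C) := mul_le_mul_of_nonneg_left this hpos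
      _ = w t := rfl
  rw [← hlhs, habel]
  have hCQ : 0 ≤ C / Real.log Q := by
    have h0 : 0 ≤ C := by
      have := hC 1 le_rfl
      exact (abs_nonneg _).trans this
    positivity
  have e1 : 2 * C / Real.log P = C / Real.log P + C / Real.log P := by ring
  linarith

/-- `∑_{w ≤ p < z} ρ_G(p)/p ≤ log(log z / log w) + C₂ / log w` for `2 ≤ w < z` (`ρ_G(2) ≤ 1`).
[folklore] -/
theorem sum_rhoG_div_filter_le (ha : 0 < a) (hc : Odd c) (hirr : Irreducible (quadPoly a b c))
    {C : ℝ} (hC : ∀ t : ℝ, 1 ≤ t → |rhoLogSumG a b c t - Real.log t| ≤ C)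
    {w z : ℝ} (hw : 2 ≤ w) (hwz : w < z) :
    ∑ p ∈ (Nat.primesBelow ⌈z⌉₊).filter (fun p : ℕ => w ≤ (p : ℝ)), (rhoG a b c p : ℝ) / p ≤
      Real.log (Real.log z / Real.log w) + (5 + 12 * C) / Real.log w := by
  have hC0 : 0 ≤ C := by
    have := hC 1 le_rfl
    exact (abs_nonneg _).trans this
  have hz2 : 2 < z := by linarith
  have hlogw : 0 < Real.log w := Real.log_pos (by linarith)
  have hlogz : 0 < Real.log z := Real.log_pos (by linarith)
  have hnonneg : ∀ p ∈ (Ioc ⌊w - 1⌋₊ ⌊z⌋₊).filter Nat.Prime, (0 : ℝ) ≤ (rhoG a b c p : ℝ) / p :=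
    fun p _ => by positivity
  rw [Real.log_div hlogz.ne' hlogw.ne']
  by_cases h3 : 3 ≤ w
  · -- `w ≥ 3`: compare with the tail over `(w − 1, z]`
    have hsub := primesBelow_filter_subset (z := z) (show (1 : ℝ) ≤ w by linarith)
    have h1 : (2 : ℝ) ≤ w - 1 := by linarith
    have hmain := sum_Ioc_rhoG_div_le hC h1 (by linarith : w - 1 ≤ z)
    have hfl : ⌊w - 1⌋₊ = ⌊w - 1⌋₊ := rfl
    have hle := (Finset.sum_le_sum_of_subset_of_nonneg hsub fun p hp _ => hnonneg p hp).trans hmain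
    -- `log log w − log log (w−1) ≤ (1/2)/log(w−1)` and `1/log(w−1) ≤ 2/log w`
    have hlw1 : 0 < Real.log (w - 1) := Real.log_pos (by linarith)
    have hA : Real.log (Real.log w) - Real.log (Real.log (w - 1)) ≤ (1 / 2) / Real.log (w - 1) := by
      rw [← Real.log_div hlogw.ne' hlw1.ne']
      have h := Real.log_le_sub_one_of_pos (div_pos hlogw hlw1)
      have h2 : Real.log w / Real.log (w - 1) - 1 = (Real.log w - Real.log (w - 1)) / Real.log (w - 1) := by
        field_simp
      have h3' : Real.log w - Real.log (w - 1) ≤ 1 / 2 := by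
        rw [← Real.log_div (by linarith) (by linarith)]
        have := Real.log_le_sub_one_of_pos (show 0 < w / (w - 1) by positivity)
        have h4 : w / (w - 1) - 1 = 1 / (w - 1) := by field_simp; ring
        rw [h4] at this
        calc Real.log (w / (w - 1)) ≤ 1 / (w - 1) := this
          _ ≤ 1 / 2 := by
            rw [div_le_div_iff₀ (by linarith) (by norm_num)]; linarith
      calc Real.log (Real.log w / Real.log (w - 1)) ≤ Real.log w / Real.log (w - 1) - 1 := h
        _ = (Real.log w - Real.log (w - 1)) / Real.log (w - 1) := h2
        _ ≤ (1 / 2) / Real.log (w - 1) := by gcongr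
    have hB : 1 / Real.log (w - 1) ≤ 2 / Real.log w := by
      -- `log w ≤ 2 log (w − 1)` since `w ≤ (w−1)²`
      have h5 : Real.log w ≤ 2 * Real.log (w - 1) := by
        rw [← Real.log_rpow (by linarith), show ((w - 1) ^ (2 : ℝ)) = (w - 1) ^ 2 by norm_cast]
        exact Real.log_le_log (by linarith) (by nlinarith)
      rw [div_le_div_iff₀ hlw1 hlogw]
      linarith
    have hB' : 0 < 1 / Real.log (w - 1) := by positivity
    calc ∑ p ∈ (Nat.primesBelow ⌈z⌉₊).filter (fun p : ℕ => w ≤ (p : ℝ)), (rhoG a b c p : ℝ) / p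
        ≤ Real.log (Real.log z) - Real.log (Real.log (w - 1)) + 2 * C / Real.log (w - 1) := hle
      _ ≤ Real.log (Real.log z) - Real.log (Real.log w) + (1 / 2 + 2 * C) * (1 / Real.log (w - 1)) := by
          have e1 : 2 * C / Real.log (w - 1) = 2 * C * (1 / Real.log (w - 1)) := by ring
          have e2 : 1 / 2 / Real.log (w - 1) = (1 / 2) * (1 / Real.log (w - 1)) := by ring
          rw [e1] at hle; rw [e2] at hA
          nlinarith
      _ ≤ Real.log (Real.log z) - Real.log (Real.log w) + (1 / 2 + 2 * C) * (2 / Real.log w) := by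
          gcongr
      _ ≤ Real.log (Real.log z) - Real.log (Real.log w) + (5 + 12 * C) / Real.log w := by
          rw [mul_div_assoc']
          gcongr
          linarith
  · -- `2 ≤ w < 3`: the whole range `2 ≤ p < z`
    push Not at h3
    have hfl2 : ⌊(2 : ℝ)⌋₊ = 2 := by norm_num
    have hsub : (Nat.primesBelow ⌈z⌉₊).filter (fun p : ℕ => w ≤ (p : ℝ)) ⊆
        insert 2 ((Ioc ⌊(2 : ℝ)⌋₊ ⌊z⌋₊).filter Nat.Prime) := by
      intro p hp
      simp only [Finset.mem_filter, Nat.mem_primesBelow, Finset.mem_insert, Finset.mem_Ioc] at hp ⊢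
      obtain ⟨⟨hpz, hpp⟩, hwp⟩ := hp
      rcases hpp.two_le.eq_or_lt with h | h
      · exact Or.inl h.symm
      · refine Or.inr ⟨⟨?_, ?_⟩, hpp⟩
        · rw [hfl2]; exact h
        · have := Nat.ceil_le_floor_add_one z; omega
    have hmain := sum_Ioc_rhoG_div_le hC (le_refl (2 : ℝ)) hz2.le
    have h2notin : (2 : ℕ) ∉ (Ioc ⌊(2 : ℝ)⌋₊ ⌊z⌋₊).filter Nat.Prime := by
      rw [hfl2]; simp
    have hnonneg' : ∀ p ∈ insert 2 ((Ioc ⌊(2 : ℝ)⌋₊ ⌊z⌋₊).filter Nat.Prime),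
        (0 : ℝ) ≤ (rhoG a b c p : ℝ) / p := fun p _ => by positivity
    have hle : ∑ p ∈ (Nat.primesBelow ⌈z⌉₊).filter (fun p : ℕ => w ≤ (p : ℝ)), (rhoG a b c p : ℝ) / p ≤
        1 / 2 + (Real.log (Real.log z) - Real.log (Real.log 2) + 2 * C / Real.log 2) := by
      calc ∑ p ∈ (Nat.primesBelow ⌈z⌉₊).filter (fun p : ℕ => w ≤ (p : ℝ)), (rhoG a b c p : ℝ) / p
          ≤ ∑ p ∈ insert 2 ((Ioc ⌊(2 : ℝ)⌋₊ ⌊z⌋₊).filter Nat.Prime), (rhoG a b c p : ℝ) / p :=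
            Finset.sum_le_sum_of_subset_of_nonneg hsub fun p hp _ => hnonneg' p hp
        _ = (rhoG a b c 2 : ℝ) / 2 + ∑ p ∈ (Ioc ⌊(2 : ℝ)⌋₊ ⌊z⌋₊).filter Nat.Prime, (rhoG a b c p : ℝ) / p := by
            rw [Finset.sum_insert h2notin]; norm_num
        _ ≤ 1 / 2 + (Real.log (Real.log z) - Real.log (Real.log 2) + 2 * C / Real.log 2) := by
            have hρ2 : (rhoG a b c 2 : ℝ) ≤ 1 := by
              have := polyRootCountMod_quadPoly_lt ha hc hirr Nat.prime_two
              have h' : rhoG a b c 2 ≤ 1 := by unfold rhoG; omega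
              exact_mod_cast h'
            linarith
    -- numerical facts
    have hlog2 : 1 / 2 < Real.log 2 := by have := Real.log_two_gt_d9; linarith
    have hlog2' : 0 < Real.log 2 := by linarith
    have hlog3le : Real.log 3 ≤ 2 := by
      have := Real.log_le_sub_one_of_pos (show (0 : ℝ) < 3 by norm_num); linarith
    have hlog3 : 0 < Real.log 3 := Real.log_pos (by norm_num)
    have hlogw3 : Real.log w < Real.log 3 := Real.log_lt_log (by linarith) h3
    have hll : Real.log (Real.log w) < Real.log (Real.log 3) := Real.log_lt_log hlogw hlogw3
    have h32 : Real.log (Real.log 3) - Real.log (Real.log 2) ≤ 2 := by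
      rw [← Real.log_div hlog3.ne' hlog2'.ne']
      have h := Real.log_le_sub_one_of_pos (div_pos hlog3 hlog2')
      have h' : Real.log 3 / Real.log 2 ≤ 3 := by
        rw [div_le_iff₀ hlog2']
        have : Real.log 3 ≤ Real.log 8 := Real.log_le_log (by norm_num) (by norm_num)
        have h8 : Real.log 8 = 3 * Real.log 2 := by
          rw [show (8 : ℝ) = 2 ^ 3 by norm_num, Real.log_pow]; push_cast; ring
        linarith
      linarith
    have hCw : (5 + 12 * C) / 2 ≤ (5 + 12 * C) / Real.log w := by
      apply div_le_div_of_nonneg_left (by linarith) hlogw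
      linarith
    have hC2 : 2 * C / Real.log 2 ≤ 4 * C := by
      rw [div_le_iff₀ hlog2']; nlinarith
    linarith

/-- `ρ_G(p)/p ≤ 2/3` for every prime `p` (`ρ_G(2) ≤ 1`, `ρ_G(p) ≤ 2` for `p ≥ 3`; the value
`2/3` is attained, e.g. `G = n² + 3n + 5`, `p = 3`). [folklore] -/
theorem rhoG_div_le_two_thirds (ha : 0 < a) (hc : Odd c) (hirr : Irreducible (quadPoly a b c))
    {p : ℕ} (hp : p.Prime) : (rhoG a b c p : ℝ) / p ≤ 2 / 3 := by
  have hp0 : (0 : ℝ) < p := by exact_mod_cast hp.pos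
  rw [div_le_iff₀ hp0]
  rcases hp.two_le.eq_or_lt with h | h
  · subst h
    have := polyRootCountMod_quadPoly_lt ha hc hirr Nat.prime_two
    have h' : rhoG a b c 2 ≤ 1 := by unfold rhoG; omega
    have h'' : (rhoG a b c 2 : ℝ) ≤ 1 := by exact_mod_cast h'
    norm_num; linarith
  · have h2 := rhoG_le_two ha hc hirr hp
    have : (rhoG a b c p : ℝ) ≤ 2 := by exact_mod_cast h2
    have : (3 : ℝ) ≤ p := by exact_mod_cast h
    linarith

/-- `−log(1 − t) ≤ t + 3t²` for `t ≤ 2/3`, in the form `(1 − t)⁻¹ ≤ exp(t + 3t²)`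
(`t/(1 − t) ≤ t + 3t² ⟺ t²(2 − 3t) ≥ 0`). [folklore] -/
theorem inv_one_sub_le_exp_of_le_two_thirds {t : ℝ} (h1 : t ≤ 2 / 3) :
    (1 - t)⁻¹ ≤ Real.exp (t + 3 * t ^ 2) := by
  have hpos : 0 < 1 - t := by linarith
  rw [← Real.exp_log (inv_pos.mpr hpos), Real.exp_le_exp]
  have h := Real.log_le_sub_one_of_pos (inv_pos.mpr hpos)
  have h2 : (1 - t)⁻¹ - 1 = t / (1 - t) := by field_simp; ring
  rw [h2] at h
  refine h.trans ?_
  rw [div_le_iff₀ hpos]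
  nlinarith [sq_nonneg t]

/-- `∑_{w ≤ p < z} (ρ_G(p)/p)² ≤ 8 / w` for `w ≥ 2`. [folklore] -/
theorem sum_rhoG_div_sq_le (ha : 0 < a) (hc : Odd c) (hirr : Irreducible (quadPoly a b c))
    {w z : ℝ} (hw : 2 ≤ w) :
    ∑ p ∈ (Nat.primesBelow ⌈z⌉₊).filter (fun p : ℕ => w ≤ (p : ℝ)), ((rhoG a b c p : ℝ) / p) ^ 2 ≤
      8 / w := by
  set k : ℕ := ⌈w⌉₊ - 1 with hk
  have hceil : 1 ≤ ⌈w⌉₊ := Nat.one_le_iff_ne_zero.mpr (Nat.ceil_pos.mpr (by linarith)).ne'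
  set S := (Nat.primesBelow ⌈z⌉₊).filter (fun p : ℕ => w ≤ (p : ℝ)) with hS
  have hsub : S ⊆ Ioo k ⌈z⌉₊ := by
    intro p hp
    simp only [hS, Finset.mem_filter, Nat.mem_primesBelow, Finset.mem_Ioo] at hp ⊢
    obtain ⟨⟨hpz, hpp⟩, hwp⟩ := hp
    refine ⟨?_, hpz⟩
    have : ⌈w⌉₊ ≤ p := Nat.ceil_le.mpr hwp
    omega
  have h1 : ∀ p ∈ S, ((rhoG a b c p : ℝ) / p) ^ 2 ≤ 4 * ((p : ℝ) ^ 2)⁻¹ := by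
    intro p hp
    have hpp : p.Prime := (Nat.mem_primesBelow.mp (Finset.mem_filter.mp hp).1).2
    have h2 : (rhoG a b c p : ℝ) ≤ 2 := by exact_mod_cast rhoG_le_two ha hc hirr hpp
    have hp0 : (0 : ℝ) < p := by exact_mod_cast hpp.pos
    rw [div_pow, div_eq_mul_inv]
    gcongr
    have h0 : (0 : ℝ) ≤ rhoG a b c p := Nat.cast_nonneg _
    nlinarith
  calc ∑ p ∈ S, ((rhoG a b c p : ℝ) / p) ^ 2 ≤ ∑ p ∈ S, 4 * ((p : ℝ) ^ 2)⁻¹ := Finset.sum_le_sum h1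
    _ ≤ ∑ i ∈ Ioo k ⌈z⌉₊, 4 * ((i : ℝ) ^ 2)⁻¹ :=
        Finset.sum_le_sum_of_subset_of_nonneg hsub fun i _ _ => by positivity
    _ = 4 * ∑ i ∈ Ioo k ⌈z⌉₊, ((i : ℝ) ^ 2)⁻¹ := by rw [Finset.mul_sum]
    _ ≤ 4 * (2 / (k + 1)) := by gcongr; exact sum_Ioo_inv_sq_le k ⌈z⌉₊
    _ = 8 / (⌈w⌉₊ : ℝ) := by
        rw [hk, Nat.cast_sub hceil]; push_cast; ring
    _ ≤ 8 / w := div_le_div_of_nonneg_left (by norm_num) (by linarith) (Nat.le_ceil w)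

/-- **Condition (1) of Lemma 2 for `ω = ρ_G`** from Mertens I for `ρ_G`: there is `K ≥ 1` with
`∏_{w ≤ p < z} (1 − ρ_G(p)/p)⁻¹ ≤ (log z / log w)(1 + K / log w)` for all `2 ≤ w < z`.
[folklore] -/
theorem prod_inv_one_sub_rhoG_div_le (ha : 0 < a) (hc : Odd c)
    (hirr : Irreducible (quadPoly a b c)) {C : ℝ}
    (hC : ∀ t : ℝ, 1 ≤ t → |rhoLogSumG a b c t - Real.log t| ≤ C) :
    ∃ K : ℝ, 1 ≤ K ∧ ∀ w z : ℝ, 2 ≤ w → w < z →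
      ∏ p ∈ (Nat.primesBelow ⌈z⌉₊).filter (fun p : ℕ => w ≤ (p : ℝ)), (1 - (rhoG a b c p : ℝ) / p)⁻¹ ≤
        Real.log z / Real.log w * (1 + K / Real.log w) := by
  have hC0 : 0 ≤ C := by
    have := hC 1 le_rfl
    exact (abs_nonneg _).trans this
  set C₃ : ℝ := 5 + 12 * C + 24 with hC₃
  have hC₃0 : 0 ≤ C₃ := by rw [hC₃]; linarith
  have hlog2 : 0 < Real.log 2 := Real.log_pos (by norm_num)
  refine ⟨C₃ * Real.exp (C₃ / Real.log 2), ?_, ?_⟩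
  · have h1 : (1 : ℝ) ≤ Real.exp (C₃ / Real.log 2) := Real.one_le_exp (by positivity)
    have h16 : (16 : ℝ) ≤ C₃ := by rw [hC₃]; linarith
    nlinarith
  intro w z hw hwz
  set S := (Nat.primesBelow ⌈z⌉₊).filter (fun p : ℕ => w ≤ (p : ℝ)) with hS
  have hlogw : 0 < Real.log w := Real.log_pos (by linarith)
  have hlogz : 0 < Real.log z := Real.log_pos (by linarith)
  have hlogw2 : Real.log 2 ≤ Real.log w := Real.log_le_log (by norm_num) hw
  have hmemS : ∀ p ∈ S, p.Prime := fun p hp =>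
    (Nat.mem_primesBelow.mp (Finset.mem_filter.mp hp).1).2
  -- each factor is at most `exp(t + 3t²)`
  have hfac : ∀ p ∈ S, (1 - (rhoG a b c p : ℝ) / p)⁻¹ ≤
      Real.exp ((rhoG a b c p : ℝ) / p + 3 * ((rhoG a b c p : ℝ) / p) ^ 2) := fun p hp =>
    inv_one_sub_le_exp_of_le_two_thirds (rhoG_div_le_two_thirds ha hc hirr (hmemS p hp))
  have hnn : ∀ p ∈ S, 0 ≤ (1 - (rhoG a b c p : ℝ) / p)⁻¹ := fun p hp => by
    have := rhoG_div_le_two_thirds ha hc hirr (hmemS p hp)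
    exact inv_nonneg.mpr (by linarith)
  have h1 : ∏ p ∈ S, (1 - (rhoG a b c p : ℝ) / p)⁻¹ ≤
      Real.exp (∑ p ∈ S, ((rhoG a b c p : ℝ) / p + 3 * ((rhoG a b c p : ℝ) / p) ^ 2)) := by
    rw [Real.exp_sum]
    exact Finset.prod_le_prod hnn hfac
  have h2 : ∑ p ∈ S, ((rhoG a b c p : ℝ) / p + 3 * ((rhoG a b c p : ℝ) / p) ^ 2) ≤
      Real.log (Real.log z / Real.log w) + C₃ / Real.log w := by
    rw [Finset.sum_add_distrib, ← Finset.mul_sum]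
    have hA := sum_rhoG_div_filter_le ha hc hirr hC hw hwz
    have hB := sum_rhoG_div_sq_le ha hc hirr (z := z) hw
    have hw0 : 0 < w := by linarith
    have hlw : Real.log w ≤ w := by
      have := Real.log_le_sub_one_of_pos hw0; linarith
    have h24 : 3 * (8 / w) ≤ 24 / Real.log w := by
      rw [show 3 * (8 / w) = 24 / w by ring]
      exact div_le_div_of_nonneg_left (by norm_num) hlogw hlw
    have : (5 + 12 * C) / Real.log w + 24 / Real.log w = C₃ / Real.log w := by
      rw [hC₃]; ring
    linarith
  have h3 : Real.exp (Real.log (Real.log z / Real.log w) + C₃ / Real.log w) =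
      Real.log z / Real.log w * Real.exp (C₃ / Real.log w) := by
    rw [Real.exp_add, Real.exp_log (div_pos hlogz hlogw)]
  have h4 : Real.exp (C₃ / Real.log w) ≤ 1 + C₃ * Real.exp (C₃ / Real.log 2) / Real.log w := by
    have hu := exp_le_one_add_mul_exp (C₃ / Real.log w)
    have hmono : Real.exp (C₃ / Real.log w) ≤ Real.exp (C₃ / Real.log 2) :=
      Real.exp_le_exp.mpr (div_le_div_of_nonneg_left hC₃0 hlog2 hlogw2)
    have hu0 : 0 ≤ C₃ / Real.log w := by positivity
    calc Real.exp (C₃ / Real.log w) ≤ 1 + C₃ / Real.log w * Real.exp (C₃ / Real.log w) := hu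
      _ ≤ 1 + C₃ / Real.log w * Real.exp (C₃ / Real.log 2) := by gcongr
      _ = 1 + C₃ * Real.exp (C₃ / Real.log 2) / Real.log w := by ring
  calc ∏ p ∈ S, (1 - (rhoG a b c p : ℝ) / p)⁻¹
      ≤ Real.exp (∑ p ∈ S, ((rhoG a b c p : ℝ) / p + 3 * ((rhoG a b c p : ℝ) / p) ^ 2)) := h1
    _ ≤ Real.exp (Real.log (Real.log z / Real.log w) + C₃ / Real.log w) := Real.exp_le_exp.mpr h2
    _ = Real.log z / Real.log w * Real.exp (C₃ / Real.log w) := h3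
    _ ≤ Real.log z / Real.log w * (1 + C₃ * Real.exp (C₃ / Real.log 2) / Real.log w) := by
        gcongr


/-- **Condition (1) of Lemma 2 (`lemma2_bilinearSieve`) for `ω = ρ_G` — PROVED**: there is
`K = K_G ≥ 1` with `∏_{w ≤ p < z} (1 − ρ_G(p)/p)⁻¹ ≤ (log z/log w)(1 + K/log w)` for all
`2 ≤ w < z` (Iwaniec 1978, p. 185: "by our assumption on the sifting density of `ρ`", for the
general `G` of the Theorem; Lemke Oliver, Lemma 2; Acta Arith. 37 (1980), condition (1) p. 308).
[cite: IwaniecInventiones1978, §5 p. 185] -/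
theorem rhoG_sieveConditionOne (ha : 0 < a) (hc : Odd c) (hirr : Irreducible (quadPoly a b c)) :
    ∃ K : ℝ, 1 ≤ K ∧ ∀ w z : ℝ, 2 ≤ w → w < z →
      ∏ p ∈ (Nat.primesBelow ⌈z⌉₊).filter (fun p : ℕ => w ≤ (p : ℝ)), (1 - (rhoG a b c p : ℝ) / p)⁻¹ ≤
        Real.log z / Real.log w * (1 + K / Real.log w) := by
  obtain ⟨C, hC⟩ := rhoMertensStrongG ha hc hirr
  exact prod_inv_one_sub_rhoG_div_le ha hc hirr hC

/-- The tail form of Mertens II for `ρ_G` with a constant `C₂ = C₂(G)` — PROVED: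
`∑_{w ≤ p < z} ρ_G(p)/p ≤ log(log z / log w) + C₂ / log w` for `2 ≤ w < z`. [folklore] -/
theorem exists_sum_rhoG_div_filter_le (ha : 0 < a) (hc : Odd c)
    (hirr : Irreducible (quadPoly a b c)) :
    ∃ C₂ : ℝ, ∀ w z : ℝ, 2 ≤ w → w < z →
      ∑ p ∈ (Nat.primesBelow ⌈z⌉₊).filter (fun p : ℕ => w ≤ (p : ℝ)), (rhoG a b c p : ℝ) / p ≤
        Real.log (Real.log z / Real.log w) + C₂ / Real.log w := by
  obtain ⟨C, hC⟩ := rhoMertensStrongG ha hc hirr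
  exact ⟨5 + 12 * C, fun w z hw hwz => sum_rhoG_div_filter_le ha hc hirr hC hw hwz⟩


end Literature.NumberTheory.Sieve.Iwaniec1978

end
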